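import Literature.NumberTheory.Congruences.DworkCongruencesGhostTerms
import HarnessLib

/-!
# Dwork congruences for constant terms — the generating-series form (Mellit–Vlasenko 2016, Theorem 1)

Topic `Literature/NumberTheory/Congruences`, namespace `Literature.NumberTheory.Congruences.DworkCongruences`
(third file of the series: `DworkCongruences.lean` = vocabulary, the two NAMED FACTS and "first-block recursion ⇒
(D3)"; `DworkCongruencesGhostTerms.lean` = the ghost-term construction of [MellitVlasenko2016, §§2–4] and the
first-block recursion (Lemma 1) for `b_n = [Λ^n]_0`). Source: A. Mellit, M. Vlasenko, *Dwork's congruences for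
the constant terms of powers of a Laurent polynomial*, Int. J. Number Theory **12** (2016) 313–321 =
arXiv:1306.5811 [MellitVlasenko2016]. Everything here is PROVED; the end product is
**`mellitVlasenko2016_theorem1_holds`**, discharging the named fact `mellitVlasenko2016_theorem1`
([MellitVlasenko2016, Thm. 1 (2)]: `f_{s+1}(X) f_{s−1}(X^p) ≡ f_s(X) f_s(X^p) mod p^s ℤ_p[X]`).

## The argument (a DEVIATION from the printed §5, recorded as such)

The source proves (2) from Lemma 1 ((A1): `b_n = Σ_{n = n^{(1)}*⋯*n^{(r)}} c_{n^{(1)}} ⋯ c_{n^{(r)}}`,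
(A2): `c_n ≡ 0 mod p^{ℓ(n)−1}`) by a bijection between "good pairs of partitions" (§5). We reach (2) from the same
Lemma 1 by a shorter, purely algebraic induction (this seat's own route; the printed bijection is not formalised):

* **Truncation identities** (`truncPoly_eq_sum_blockPoly`): with `f_s(X) = Σ_{n<p^s} b_n X^n` (`truncPoly`, so
  `f_0 = b_0`) and `C_j(X) := Σ_{ℓ(k) = j} c_k X^k` (`blockPoly`; `p^{j−1} ∣ C_j` by (A2), `blockPoly_dvd`), the
  first-block recursion gives the EXACT identities `f_s(X) = Σ_{j=1}^{s} C_j(X) f_{s−j}(X^{p^j})` (`s ≥ 1`):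
  a monomial `X^n`, `n < p^s`, of the `j`-th summand is `X^{k + p^j n'}` with `ℓ(k) = j`, `n' < p^{s−j}`, i.e.
  exactly an admissible first block `k = n mod p^j` of `n` (the bijection `n ↔ (n mod p^j, ⌊n/p^j⌋)`,
  `sum_blockValid_eq_sum_blocks`).
* **Induction** (`truncPoly_prefix_congr`): for `1 ≤ i ≤ s`,
  `E(s,i) : p^{s+1−i} ∣ f_{s+1}(X) f_{s−i}(X^{p^i}) − f_s(X) f_{s+1−i}(X^{p^i})`; (2) is `E(s,1)`. Expanding
  `f_{s+1}` and `f_s` by the truncation identities, the `j = i` terms cancel, the `j < i` terms are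
  `C_j · (E(s−j, i−j))(X^{p^j})`, the `i < j ≤ s` terms are `C_j · (E(s−i, j−i))(X^{p^i})` with
  `p^{j−1} · p^{s+1−j} = p^s`, and the `j = s+1` term carries `C_{s+1} ≡ 0 mod p^s`.
* `mellitVlasenko2016_theorem1_holds`: `b_n = [Λ^n]_0`, `c_n = [I_Λ^n]_0` over `ℤ_p`
  (`ctPow_blockRecursion`, `cseq_dvd` of the sibling file; `a^p ≡ a mod p` in `ℤ_p` via `PadicInt.toZMod`).

As with (D3), the series congruence is proved for ANY sequence with a first-block recursion
(`mv_congruence_of_blockRecursion`), over any commutative ring.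
-/

noncomputable section

open Finset Polynomial

namespace Literature.NumberTheory.Congruences.DworkCongruences

variable {R : Type*} [CommRing R] {p : ℕ}

/-! ## Truncated generating polynomials and block polynomials -/

/-- `f_s(X) = Σ_{n=0}^{p^s−1} b_n X^n` for an abstract sequence `b` (for `b_n = [Λ^n]_0` this is `truncGF`).
[cite: MellitVlasenko2016, Thm. 1 (`f_s`)] -/
def truncPoly (b : ℕ → R) (p s : ℕ) : R[X] := ∑ n ∈ range (p ^ s), C (b n) * X ^ n

/-- `C_j(X) = Σ_{k : ℓ(k) = j} c_k X^k`, the generating polynomial of the `c`'s of the blocks of length `j`.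
[cite: MellitVlasenko2016, Lemma 1 (A1) (blocks `n^{(i)}` of length `ℓ(n^{(i)})`)] -/
def blockPoly (c : ℕ → R) (p j : ℕ) : R[X] :=
  ∑ k ∈ (range (p ^ j)).filter (fun k => len p k = j), C (c k) * X ^ k

/-- `truncGF Λ p s = truncPoly (ctPow Λ) p s`. [cite: MellitVlasenko2016, Thm. 1 (`f_s`)] -/
theorem truncGF_eq_truncPoly {d : ℕ} (Λ : LaurentPoly R d) (p s : ℕ) :
    truncGF Λ p s = truncPoly (ctPow Λ) p s := rfl

section BlockRecursion

variable {b c : ℕ → R}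

/-- (A2) for the block polynomials: `p^{j−1} ∣ C_j(X)`. [cite: MellitVlasenko2016, Lemma 1 (A2)] -/
theorem blockPoly_dvd (hc : ∀ k, (p : R) ^ (len p k - 1) ∣ c k) (j : ℕ) :
    (p : R[X]) ^ (j - 1) ∣ blockPoly c p j := by
  unfold blockPoly
  refine Finset.dvd_sum fun k hk => ?_
  rw [Finset.mem_filter] at hk
  obtain ⟨r, hr⟩ := hc k
  rw [hk.2] at hr
  rw [hr, C_mul, map_pow, map_natCast, mul_assoc]
  exact dvd_mul_right _ _

/-- A number of length `j` has a non-trivial lowest block of length `j`: `ℓ(k) = j`, `n' ≥ 0` ⇒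
`BlockValid (k + p^j n') j`. [cite: MellitVlasenko2016, §1 (notation `n^{(1)} * ⋯ * n^{(r)}`)] -/
theorem blockValid_block (hp : 1 < p) {k j : ℕ} (hk : k < p ^ j) (hlen : len p k = j) (n' : ℕ) :
    BlockValid p (k + p ^ j * n') j := by
  rcases eq_or_ne j 1 with rfl | hj1
  · exact Or.inl rfl
  · right
    have hj : 1 ≤ j := by rw [← hlen]; simp [len]
    rw [prefix_digit hp (by omega)]
    have hk0 : k ≠ 0 := by rintro rfl; simp [len] at hlen; omega
    have h1 : p ^ (j - 1) ≤ k := by rw [← hlen]; exact pow_len_sub_one_le hk0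
    have h2 : k / p ^ (j - 1) < p := by
      rw [Nat.div_lt_iff_lt_mul (by positivity), ← pow_succ', show j - 1 + 1 = j by omega]; exact hk
    rw [Nat.mod_eq_of_lt h2]
    exact Nat.ne_of_gt (Nat.div_pos h1 (by positivity))

/-- The bijection `n ↔ (n mod p^j, ⌊n/p^j⌋)` between `{n < p^s : BlockValid p n j}` and
`{k < p^j : ℓ(k) = j} × {n' < p^{s−j}}` (`1 ≤ j ≤ s`), at the level of the monomials of the truncation identity.
[cite: MellitVlasenko2016, Lemma 1 (A1) (first block of a partition)] -/
theorem sum_blockValid_eq_sum_blocks (hp : 1 < p) {s j : ℕ} (hj : 1 ≤ j) (hjs : j ≤ s) :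
    ∑ n ∈ (range (p ^ s)).filter (fun n => BlockValid p n j), C (c (n % p ^ j) * b (n / p ^ j)) * X ^ n =
      ∑ k ∈ (range (p ^ j)).filter (fun k => len p k = j), ∑ n' ∈ range (p ^ (s - j)),
        C (c k) * X ^ k * (C (b n') * X ^ (p ^ j * n')) := by
  rw [← Finset.sum_product']
  refine Finset.sum_bij' (fun n _ => (n % p ^ j, n / p ^ j)) (fun kn _ => kn.1 + p ^ j * kn.2) ?_ ?_ ?_ ?_ ?_
  · intro n hn
    simp only [Finset.mem_filter, Finset.mem_range] at hn
    simp only [Finset.mem_product, Finset.mem_filter, Finset.mem_range]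
    refine ⟨⟨Nat.mod_lt _ (by positivity), len_mod_pow_of_blockValid hp hj hn.2⟩, ?_⟩
    apply Nat.div_lt_of_lt_mul
    rw [← pow_add, Nat.add_sub_cancel' hjs]; exact hn.1
  · intro kn hkn
    simp only [Finset.mem_product, Finset.mem_filter, Finset.mem_range] at hkn
    simp only [Finset.mem_filter, Finset.mem_range]
    refine ⟨?_, blockValid_block hp hkn.1.1 hkn.1.2 kn.2⟩
    calc kn.1 + p ^ j * kn.2 < p ^ j + p ^ j * kn.2 := by omega
      _ = p ^ j * (kn.2 + 1) := by ring
      _ ≤ p ^ j * p ^ (s - j) := Nat.mul_le_mul_left _ hkn.2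
      _ = p ^ s := by rw [← pow_add, Nat.add_sub_cancel' hjs]
  · intro n hn
    exact Nat.mod_add_div n (p ^ j)
  · intro kn hkn
    simp only [Finset.mem_product, Finset.mem_filter, Finset.mem_range] at hkn
    ext
    · simp only
      rw [prefix_mod le_rfl, Nat.mod_eq_of_lt hkn.1.1]
    · simp only
      rw [prefix_div hp le_rfl, Nat.div_eq_of_lt hkn.1.1, Nat.sub_self, pow_zero, one_mul, zero_add]
  · intro n hn
    simp only
    rw [map_mul, mul_mul_mul_comm, ← pow_add, Nat.mod_add_div]

/-- **Truncation identities:** `f_s(X) = Σ_{j=1}^{s} C_j(X) f_{s−j}(X^{p^j})` for `s ≥ 1`, from the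
first-block recursion (`f_0 = b_0`). [cite: MellitVlasenko2016, Lemma 1 (A1)] -/
theorem truncPoly_eq_sum_blockPoly (hp : 1 < p)
    (hrec : ∀ n, b n = ∑ j ∈ Icc 1 (len p n),
      if BlockValid p n j then c (n % p ^ j) * b (n / p ^ j) else 0)
    {s : ℕ} (hs : 1 ≤ s) :
    truncPoly b p s = ∑ j ∈ Icc 1 s, blockPoly c p j * expand R (p ^ j) (truncPoly b p (s - j)) := by
  -- right-hand side as a triple sum of monomials
  have hR : ∀ j ∈ Icc 1 s, blockPoly c p j * expand R (p ^ j) (truncPoly b p (s - j)) =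
      ∑ n ∈ (range (p ^ s)).filter (fun n => BlockValid p n j), C (c (n % p ^ j) * b (n / p ^ j)) * X ^ n := by
    intro j hj
    rw [mem_Icc] at hj
    rw [sum_blockValid_eq_sum_blocks hp hj.1 hj.2]
    unfold blockPoly truncPoly
    rw [map_sum, Finset.sum_mul_sum]
    refine Finset.sum_congr rfl fun k _ => Finset.sum_congr rfl fun n' _ => ?_
    rw [map_mul, expand_C, map_pow, expand_X, ← pow_mul]
  rw [Finset.sum_congr rfl hR]
  -- left-hand side: expand each `b n` by the recursion, summed up to `s`
  unfold truncPoly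
  have hL : ∀ n ∈ range (p ^ s), C (b n) * X ^ n =
      ∑ j ∈ Icc 1 s, if BlockValid p n j then C (c (n % p ^ j) * b (n / p ^ j)) * X ^ n else 0 := by
    intro n hn
    rw [Finset.mem_range] at hn
    rw [blockRecursion_ext hp hrec ((len_le_iff hp (by omega)).2 hn), map_sum, Finset.sum_mul]
    refine Finset.sum_congr rfl fun j _ => ?_
    split_ifs <;> simp
  rw [Finset.sum_congr rfl hL, Finset.sum_comm]
  refine Finset.sum_congr rfl fun j _ => ?_
  rw [Finset.sum_filter]

/-- **`E(s, i)`:** `p^{s+1−i} ∣ f_{s+1}(X) f_{s−i}(X^{p^i}) − f_s(X) f_{s+1−i}(X^{p^i})` for `1 ≤ i ≤ s`, by strong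
induction on `s` from the truncation identities and `p^{j−1} ∣ C_j`. [cite: MellitVlasenko2016, Thm. 1 (2)
(our inductive route from Lemma 1)] -/
theorem truncPoly_prefix_congr (hp : 1 < p)
    (hrec : ∀ n, b n = ∑ j ∈ Icc 1 (len p n),
      if BlockValid p n j then c (n % p ^ j) * b (n / p ^ j) else 0)
    (hc : ∀ k, (p : R) ^ (len p k - 1) ∣ c k) :
    ∀ s, 1 ≤ s → ∀ i, 1 ≤ i → i ≤ s →
      (p : R[X]) ^ (s + 1 - i) ∣
        truncPoly b p (s + 1) * expand R (p ^ i) (truncPoly b p (s - i)) -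
          truncPoly b p s * expand R (p ^ i) (truncPoly b p (s + 1 - i)) := by
  intro s
  induction s using Nat.strong_induction_on with
  | _ s IH =>
  intro hs i hi his
  set g : ℕ → R[X] := fun t => truncPoly b p t with hg
  have hT1 := truncPoly_eq_sum_blockPoly hp hrec (s := s + 1) (by omega)
  have hT0 := truncPoly_eq_sum_blockPoly hp hrec (s := s) hs
  rw [hT1, hT0, Finset.sum_Icc_succ_top (by omega : 1 ≤ s + 1), add_mul, Finset.sum_mul, Finset.sum_mul,
    show ∀ (A B D : R[X]), A + B - D = (A - D) + B from fun A B D => by ring, ← Finset.sum_sub_distrib]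
  refine dvd_add (Finset.dvd_sum fun j hj => ?_) ?_
  · -- the `j`-terms, `1 ≤ j ≤ s`
    rw [mem_Icc] at hj
    rw [show s + 1 - j = s - j + 1 by omega,
      show blockPoly c p j * expand R (p ^ j) (truncPoly b p (s - j + 1)) *
          expand R (p ^ i) (truncPoly b p (s - i)) -
        blockPoly c p j * expand R (p ^ j) (truncPoly b p (s - j)) *
          expand R (p ^ i) (truncPoly b p (s + 1 - i)) =
        blockPoly c p j * (expand R (p ^ j) (truncPoly b p (s - j + 1)) *
          expand R (p ^ i) (truncPoly b p (s - i)) -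
        expand R (p ^ j) (truncPoly b p (s - j)) * expand R (p ^ i) (truncPoly b p (s + 1 - i))) by ring]
    rcases lt_trichotomy j i with hji | rfl | hij
    · -- `j < i`: `σ^j` of `E(s - j, i - j)`
      have hIH := IH (s - j) (by omega) (by omega) (i - j) (by omega) (by omega)
      have e1 : s - j - (i - j) = s - i := by omega
      have e2 : s - j + 1 - (i - j) = s + 1 - i := by omega
      rw [e1, e2] at hIH
      have h2 := map_dvd (expand R (p ^ j)) hIH
      rw [map_pow, map_natCast, map_sub, map_mul, map_mul, expand_expand, expand_expand, ← pow_add,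
        show j + (i - j) = i by omega] at h2
      exact dvd_mul_of_dvd_right h2 _
    · -- `j = i`: the bracket vanishes
      rw [show s - j + 1 = s + 1 - j by omega, mul_comm (expand R (p ^ j) (truncPoly b p (s + 1 - j))), sub_self,
        mul_zero]
      exact dvd_zero _
    · -- `i < j ≤ s`: `C_j ≡ 0 mod p^{j-1}` times `σ^i` of `E(s - i, j - i)`
      have hIH := IH (s - i) (by omega) (by omega) (j - i) (by omega) (by omega)
      have e1 : s - i - (j - i) = s - j := by omega
      have e2 : s - i + 1 - (j - i) = s + 1 - j := by omega
      rw [e1, e2] at hIH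
      have h2 := map_dvd (expand R (p ^ i)) hIH
      rw [map_pow, map_natCast, map_sub, map_mul, map_mul, expand_expand, expand_expand, ← pow_add,
        show i + (j - i) = j by omega] at h2
      have hC := blockPoly_dvd hc j
      have hprod := mul_dvd_mul hC h2
      rw [← pow_add] at hprod
      refine (pow_dvd_pow (p : R[X]) (by omega : s + 1 - i ≤ j - 1 + (s + 1 - j))).trans ?_
      rw [show blockPoly c p j * (expand R (p ^ j) (truncPoly b p (s - j + 1)) *
            expand R (p ^ i) (truncPoly b p (s - i)) -
          expand R (p ^ j) (truncPoly b p (s - j)) * expand R (p ^ i) (truncPoly b p (s + 1 - i))) =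
          -(blockPoly c p j * (expand R (p ^ i) (truncPoly b p (s - i + 1)) *
            expand R (p ^ j) (truncPoly b p (s - j)) -
          expand R (p ^ i) (truncPoly b p (s - i)) * expand R (p ^ j) (truncPoly b p (s + 1 - j)))) by
        rw [show s - j + 1 = s + 1 - j by omega, show s - i + 1 = s + 1 - i by omega]; ring]
      exact (dvd_neg).2 hprod
  · -- the `j = s + 1` term: `C_{s+1} ≡ 0 mod p^s`
    have hC := blockPoly_dvd hc (s + 1)
    rw [Nat.add_sub_cancel] at hC
    exact dvd_mul_of_dvd_left (dvd_mul_of_dvd_left ((pow_dvd_pow (p : R[X]) (by omega)).trans hC) _) _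

/-- **Mellit–Vlasenko's congruence (2) from a first-block recursion:** for any sequence `b` over a commutative
ring with `b(n) = Σ_j [BlockValid] c(n mod p^j) b(⌊n/p^j⌋)` and `p^{ℓ(k)−1} ∣ c(k)`, and every `s ≥ 1`:
`p^s ∣ f_{s+1}(X) f_{s−1}(X^p) − f_s(X) f_s(X^p)`. [cite: MellitVlasenko2016, Thm. 1 (2)] -/
theorem mv_congruence_of_blockRecursion (hp : 1 < p)
    (hrec : ∀ n, b n = ∑ j ∈ Icc 1 (len p n),
      if BlockValid p n j then c (n % p ^ j) * b (n / p ^ j) else 0)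
    (hc : ∀ k, (p : R) ^ (len p k - 1) ∣ c k) {s : ℕ} (hs : 1 ≤ s) :
    (p : R[X]) ^ s ∣ truncPoly b p (s + 1) * expand R p (truncPoly b p (s - 1)) -
      truncPoly b p s * expand R p (truncPoly b p s) := by
  have h := truncPoly_prefix_congr hp hrec hc s hs 1 le_rfl hs
  rwa [pow_one, Nat.add_sub_cancel] at h

end BlockRecursion

/-- `a^p ≡ a mod p` in `ℤ_p`. [folklore] -/
private theorem padicInt_pow_sub_dvd (p : ℕ) [Fact p.Prime] (a : ℤ_[p]) : (p : ℤ_[p]) ∣ a ^ p - a := by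
  rw [← Ideal.mem_span_singleton, ← PadicInt.maximalIdeal_eq_span_p, ← PadicInt.ker_toZMod, RingHom.mem_ker,
    map_sub, map_pow, ZMod.pow_card, sub_self]

/-- **Mellit–Vlasenko 2016, Theorem 1 (2), PROVED:** for `Λ ∈ ℤ_p[x_1^{±1}, …, x_d^{±1}]` whose Newton polytope
contains the origin as its only interior lattice point, `f_{s+1}(X) f_{s−1}(X^p) ≡ f_s(X) f_s(X^p) mod p^s ℤ_p[X]`
for every `s ≥ 1`. [cite: MellitVlasenko2016, Thm. 1 (2)] -/
theorem mellitVlasenko2016_theorem1_holds : mellitVlasenko2016_theorem1 := by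
  intro p _ d Λ hΛ s hs
  have hp : p.Prime := Fact.out
  rw [truncGF_eq_truncPoly, truncGF_eq_truncPoly, truncGF_eq_truncPoly]
  exact mv_congruence_of_blockRecursion hp.one_lt (ctPow_blockRecursion hp Λ hΛ)
    (cseq_dvd hp (padicInt_pow_sub_dvd p) Λ) hs

end Literature.NumberTheory.Congruences.DworkCongruences
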